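import Summits.MatrixMultiplication.MatrixMultiplication.Theorems.GradedDesignFamily.Negative.SubfieldCellNineRowThreeAlt

/-!
# Subfield cell `GL₂(𝔽₉) ⊃ SL₂(𝔽₃)` at level one — IX: the row-three certificate at β = 3

**Honest framing.** VALUE = a kernel-checked finite certificate about ONE finite cell of ONE
skeleton line (`quadratic_extension_level_one_cell`, stub S3 `stub_subfieldCell`, crux
`GradedDesignFamily`, route `LevelGradedCohnUmans`).  It is **not** progress on
`Summit.MatrixMultiplication` and does **not** refute `stub_subfieldCell`.

This file is the computational half of `|Y| ≥ 3 ⇒ |Z| ≤ 15` (file X,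
`SubfieldCellNineRowThreeFifteen`), one better than files VII/VIII (`|Z| ≤ 16`).  The improvement
comes from replacing the support / coordinate reasoning of file VII by general `ℤ[√-3]`-valued
functionals (a search-and-verify checker).  For a triple `y₁, y₂, y₃ ∈ Y` put `a = y₂y₁⁻¹`,
`b = y₃y₁⁻¹`, `W = (a, a⁻¹, b, b⁻¹, ab⁻¹, ba⁻¹)`; the garbage vectors `w_{W_k z}` (`z ∈ Z`) are
killed by every dual `E_{z₀}` and `⟨w_z, E_{z₀}⟩ = 4[z = z₀]`, so (file VIII-a, `capacity`)
`|Z| + m + n ≤ 20` whenever `m` independent garbage vectors and `n` independent functionals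
killing them and all `w_z`, `z ∈ Z`, are exhibited.  The checker `nodeB` maintains a list `B` of
`m` independent garbage codes.  It computes (untrusted) an integral basis `Φ` of the annihilator
of `B` by fraction-free Gauss–Jordan elimination over `ℤ[√-3]` and VERIFIES `Φ ⟂ B`; a direction
`d` is a *member* if `Φ` vanishes on its representative.  Every `z ∈ Z` then either has some
`W_k z` of non-member direction `d` — a new garbage vector, certified independent of `B` by a
VERIFIED non-vanishing functional of `Φ` and handled by the recursive call on `dirRep d :: B` — or
is a *pool* element (all six `W_k z` of member directions; these are enumerated as `z = W₀⁻¹g`,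
`g` of member direction).  For the all-pool case the checker computes `5 − m` functionals `Ψ` and
VERIFIES that they kill `B` and the representatives of all pool directions and that they are
independent (a diagonal pattern on their free columns); then `|Z| ≤ 20 − m − (5 − m) = 15`.
Leaves: `m ≥ 4` (with the functional `𝟙`).  Roots: the six codes are dead (as in file VII), or
contain a support-triangular triple (plus, usually, a fourth support-independent code: done at
once), or two codes of distinct directions.  Only the verifications are used by the soundness
proof (file X); elimination, enumeration order and member tables are heuristics, and the tables
are verified against their specifications (`fact_cv`, `fact_dirCodes`, `fact_dirRep`).
Cross-check (Python, gen 10, `calc/row3_exact.py`): all `11 520` live pairs of garbage rank `≤ 3`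
pass the exact version of this recursion; `5 600` of the `3 075 264` pairs of rank `≥ 4` lack a
support witness of size four and go through `nodeB` as well.  Parts 2–5: files IX-b … IX-e.
-/

set_option linter.dupNamespace false

namespace Summit.MatrixMultiplication.MatrixMultiplication.Theorems.GradedDesignFamily.Negative.SubfieldNine

open Matrix

/-! ### Packed λ-code vectors (two bits per coordinate) -/

/-- field code of an optional exponent: `none ↦ 0`, `some e ↦ e + 1` -/
def ocode : Option (ZMod 3) → ℕ
  | none => 0
  | some e => e.val + 1

/-- packed code vector computed from `vcN` -/
def cvN (c : MC) : ℕ := allIdx.foldl (fun acc i => acc ||| (ocode (vcN c i) <<< (2 * posI i))) 0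

/-- table of packed code vectors -/
def cvA : Array ℕ := Array.ofFn fun n : Fin 6561 => cvN (decN n.val)

/-- packed code vector of a matrix code (table lookup) -/
def cvT (c : MC) : ℕ := cvA.getD (encN c) 0

/-- the two-bit field at position `p` -/
def fld (v p : ℕ) : ℕ := (v >>> (2 * p)) % 4

/-- Boolean form of `fact_cv`. -/
theorem fact_cvB :
    (allMC.all fun c => allIdx.all fun i => fld (cvT c) (posI i) == ocode (vcN c i)) = true := by
  native_decide

/-- The packed table agrees with `vcN`. -/
theorem fact_cv (c : MC) (i : Idx) : fld (cvT c) (posI i) = ocode (vcN c i) := by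
  have h := List.all_eq_true.mp (List.all_eq_true.mp fact_cvB c (mem_allMC c)) i (mem_allIdx i)
  simpa using h

/-! ### `ℤ[√-3]`-valued functionals -/

/-- the coefficient ring of the λ-vectors -/
abbrev ZW : Type := ℤ√(-3)

/-- value of a field code: `0 ↦ 0`, `e + 1 ↦ 2ω^e` (as in `cval`) -/
def ovalN : ℕ → ZW
  | 1 => 2
  | 2 => ⟨-1, 1⟩
  | 3 => ⟨-1, -1⟩
  | _ => 0

/-- `ovalN` decodes `ocode`. -/
theorem ovalN_ocode (o : Option (ZMod 3)) : ovalN (ocode o) = oval o := by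
  cases o with
  | none => rfl
  | some e => fin_cases e <;> decide

/-- one step of the evaluation loop: add `(value of field p) * F[p]` to the accumulator, computed on
real and imaginary parts -/
def evStep (F : Array ZW) (v : ℕ) (acc : ZW) (p : ℕ) : ZW :=
  let c := fld v p
  if c = 0 then acc else
  let a := F.getD p 0
  if c = 1 then ⟨acc.re + 2 * a.re, acc.im + 2 * a.im⟩ else
  if c = 2 then ⟨acc.re - a.re - 3 * a.im, acc.im + a.re - a.im⟩ else
  ⟨acc.re - a.re + 3 * a.im, acc.im - a.re - a.im⟩

/-- evaluation of a functional (entries indexed by position) on a packed vector -/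
def evS (F : Array ZW) (v : ℕ) : ZW := (List.range 20).foldl (evStep F v) 0

/-- `evStep` adds one term. -/
theorem evStep_eq (F : Array ZW) (v : ℕ) (acc : ZW) (p : ℕ) :
    evStep F v acc p = acc + ovalN (fld v p) * F.getD p 0 := by
  have h4 : fld v p < 4 := Nat.mod_lt _ (by decide)
  unfold evStep
  generalize fld v p = c at h4 ⊢
  interval_cases c <;> ext <;> simp [ovalN] <;> ring

/-- a `foldl` adding terms is a sum -/
theorem foldl_add_eq {α : Type} (g : α → ZW) (a : ZW) (l : List α) :
    l.foldl (fun acc x => acc + g x) a = a + (l.map g).sum := by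
  induction l generalizing a with
  | nil => simp
  | cons x l ih => simp [ih, add_assoc]

/-- positions enumerate `allIdx` -/
theorem allIdx_map_posI : allIdx.map posI = List.range 20 := by decide

/-- `evS` as a sum over `Idx` (the form used by the soundness proof). -/
theorem evS_eq (F : Array ZW) (v : ℕ) :
    evS F v = (allIdx.map fun i => ovalN (fld v (posI i)) * F.getD (posI i) 0).sum := by
  have h1 : evS F v = (List.range 20).foldl (fun acc p => acc + ovalN (fld v p) * F.getD p 0) 0 := by
    unfold evS; congr 1; funext acc p; exact evStep_eq F v acc p
  rw [h1, foldl_add_eq, zero_add, ← allIdx_map_posI, List.map_map]; rfl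

/-- sparse evaluation over a support list `S` (equal to `evS` when `sparseOK`, file X) -/
def evSp (S : List ℕ) (F : Array ZW) (v : ℕ) : ZW := S.foldl (evStep F v) 0

/-- the support list is duplicate-free, inside `[0, 20)`, and `F` vanishes outside it -/
def sparseOK (S : List ℕ) (F : Array ZW) : Bool :=
  decide S.Nodup && S.all (· < 20) && (List.range 20).all fun p => S.contains p || F.getD p 0 == 0

/-- A sparse functional: free column, support list, entries by position. -/
abbrev SFn : Type := ℕ × List ℕ × Array ZW

/-- sparse evaluation of a sparse functional -/
def SFn.ev (φ : SFn) (v : ℕ) : ZW := evSp φ.2.1 φ.2.2 v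

/-- the `ℤ[√-3]`-row (by position) of a packed vector -/
def rowOfV (v : ℕ) : Array ZW := (Array.range 20).map fun p => ovalN (fld v p)

/-- exact division in `ℤ[√-3]` (used only when the quotient is integral) -/
def zdiv (x y : ZW) : ZW :=
  let n := y.re * y.re + 3 * y.im * y.im
  ⟨(x.re * y.re + 3 * x.im * y.im) / n, (x.im * y.re - x.re * y.im) / n⟩

/-- fraction-free Gauss–Jordan elimination (Bareiss form) of rows of length `20`: returns the reduced
rows, the pivot columns in row order and the last pivot `D` (untrusted search code) -/
def ffgj (rows : Array (Array ZW)) : Array (Array ZW) × Array ℕ × ZW := Id.run do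
  let mut A := rows
  let mut pivs : Array ℕ := #[]
  let mut prev : ZW := 1
  let mut r : ℕ := 0
  for c in [0:20] do
    if r < A.size then
      match (List.range (A.size - r)).find? (fun t => (A.getD (r + t) #[]).getD c 0 != 0) with
      | none => pure ()
      | some t =>
        let rowi := A.getD (r + t) #[]
        let rowr := A.getD r #[]
        A := (A.set! (r + t) rowr).set! r rowi
        let p := rowi.getD c 0
        for j in [0:A.size] do
          if j != r then
            let rowj := A.getD j #[]
            let f := rowj.getD c 0
            A := A.set! j ((Array.range 20).map fun l => zdiv (p * rowj.getD l 0 - f * rowi.getD l 0) prev)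
        prev := p
        pivs := pivs.push c
        r := r + 1
  return (A, pivs, prev)

/-- integral basis of the annihilator of the given rows, one sparse functional per free column `f`
(entry `D` at `f`, `−A[k][f]` at the `k`-th pivot column; support `f ::` pivot columns; untrusted) -/
def nullBasis (rows : Array (Array ZW)) : List SFn :=
  let (A, pivs, D) := ffgj rows
  ((List.range 20).filter fun f => !pivs.contains f).map fun f =>
    (f, f :: pivs.toList, (Array.range 20).map fun l =>
      if l == f then D else
      match pivs.findIdx? (· == l) with
      | some k => -((A.getD k #[]).getD f 0)
      | none => 0)

/-! ### Directions: representatives are invertible; invertible codes grouped by direction -/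

/-- Boolean form of `fact_dirRep`. -/
theorem fact_dirRepB : ((List.range 120).all fun d => detC (dirRep d) != 0) = true := by native_decide

/-- Direction representatives are codes of invertible matrices. -/
theorem fact_dirRep (d : ℕ) (hd : d < 120) : detC (dirRep d) ≠ 0 := by
  have h := List.all_eq_true.mp fact_dirRepB d (List.mem_range.mpr hd)
  simpa using h

/-- invertible codes grouped by direction index -/
def dirCodesA : Array (List MC) :=
  allMC.foldl (fun acc c => if detC c == 0 then acc else acc.modify (dki c) (c :: ·)) (Array.replicate 120 [])

/-- the invertible codes of direction `d` -/
def dirCodes (d : ℕ) : List MC := dirCodesA.getD d []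

/-- Boolean form of `fact_dirCodes`. -/
theorem fact_dirCodesB : (allMC.all fun c => detC c == 0 || (dirCodes (dki c)).contains c) = true := by
  native_decide

/-- Every invertible code is listed under its direction. -/
theorem fact_dirCodes (c : MC) (hc : detC c ≠ 0) : c ∈ dirCodes (dki c) := by
  have h := List.all_eq_true.mp fact_dirCodesB c (mem_allMC c)
  simp only [Bool.or_eq_true, beq_iff_eq, List.contains_iff_mem] at h
  exact h.resolve_left hc

/-! ### The recursive checker -/

/-- witness table (heuristic): for each direction `d < 120` the index in `Φ` of a functional that does
not vanish on its representative, or `Φ.length` if `Φ` vanishes there (`d` is a *member*) -/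
def witA (Φ : List SFn) : Array ℕ :=
  (Array.range 120).map fun d => Φ.findIdx fun φ => φ.ev (cvT (dirRep d)) != 0

/-- the pool of `W` relative to a member predicate: codes `z = W₀⁻¹ g`, `g` of member direction, all of
whose six translates `W_k z` have member directions -/
def poolL (W : ℕ → MC) (mem : ℕ → Bool) : List MC :=
  ((List.range 120).filter mem).flatMap fun d =>
    ((dirCodes d).map fun g => mulT (invT (W 0)) g).filter fun zc =>
      (List.range 6).all fun k => mem (dki (mulT (W k) zc))

/-- `φ` is a well-formed sparse functional killing the packed vectors of all codes in `L` -/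
def killsL (φ : SFn) (L : List MC) : Bool := sparseOK φ.2.1 φ.2.2 && L.all fun u => φ.ev (cvT u) == 0

/-- `φ` kills the representatives of all directions in `ds` -/
def killsD (φ : SFn) (ds : List ℕ) : Bool := ds.all fun d => φ.ev (cvT (dirRep d)) == 0

/-- the diagonal independence pattern of sparse functionals on their free columns -/
def diagB (Ψ : List SFn) : Bool :=
  Ψ.all fun φ => φ.1 < 20 && Ψ.all fun φ' => (φ'.2.2.getD φ.1 0 == 0) == (φ.1 != φ'.1)

/-- the recursive certificate: fuel, then the current list `B` of independent garbage codes (newest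
first); see the file docstring -/
def nodeB (W : ℕ → MC) : ℕ → List MC → Bool
  | 0, _ => false
  | fuel + 1, B =>
    decide (4 ≤ B.length) ||
    (let Φ := nullBasis (B.toArray.map fun u => rowOfV (cvT u))
     let n := Φ.length
     let wit := witA Φ
     let mem : ℕ → Bool := fun d => n ≤ wit.getD d n
     let pool := poolL W mem
     let pdirs := (pool.map dki).dedup
     let prow := (pdirs.map fun d => rowOfV (cvT (dirRep d))).toArray
     let Ψ := (nullBasis ((B.toArray.map fun u => rowOfV (cvT u)) ++ prow)).take (5 - B.length)
     (Φ.all fun φ => killsL φ B) &&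
     decide (Ψ.length = 5 - B.length) &&
     (Ψ.all fun φ => killsL φ B && killsD φ pdirs) &&
     diagB Ψ &&
     (List.range 120).all fun d => mem d ||
       match Φ[wit.getD d n]? with
       | some φ => φ.ev (cvT (dirRep d)) != 0 && nodeB W fuel (dirRep d :: B)
       | none => false)

/-! ### Roots -/

/-- `y` is supported at position `p`, where `u, v, x` vanish -/
def quadAt (u v x y : MC) (p : ℕ) : Bool :=
  (vcN y (idxOfNat p)).isSome && (vcN u (idxOfNat p)).isNone && (vcN v (idxOfNat p)).isNone &&
    (vcN x (idxOfNat p)).isNone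

/-- verified search for four support-independent codes: `u, v` of distinct directions, `x` supported
at a position where `u, v` vanish, `y` supported at a position where `u, v, x` vanish -/
def quadSearch (W : ℕ → MC) (S : Array ℕ) : Bool :=
  pairs6.any fun uv => dki (W uv.1) != dki (W uv.2) &&
    (List.range 6).any fun ix =>
      let mx := S.getD ix 0 &&& (1048575 ^^^ (S.getD uv.1 0 ||| S.getD uv.2 0))
      mx != 0 && (List.range 6).any fun iy =>
        let my := S.getD iy 0 &&& (1048575 ^^^ (S.getD uv.1 0 ||| S.getD uv.2 0 ||| S.getD ix 0))
        my != 0 && triAt (W uv.1) (W uv.2) (W ix) mx.log2 &&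
          quadAt (W uv.1) (W uv.2) (W ix) (W iy) my.log2

/-- index search (untrusted): `u, v` of distinct directions and `x` supported at a position `p` where
both vanish; returns `(ku, kv, kx, p)` -/
def triFind (W : ℕ → MC) (S : Array ℕ) : Option (ℕ × ℕ × ℕ × ℕ) :=
  pairs6.findSome? fun uv => if dki (W uv.1) == dki (W uv.2) then none else
    (List.range 6).findSome? fun ix =>
      let msk := S.getD ix 0 &&& (1048575 ^^^ (S.getD uv.1 0 ||| S.getD uv.2 0))
      if msk != 0 then some (uv.1, uv.2, ix, msk.log2) else none

/-- the verified triangular test -/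
def triV (W : ℕ → MC) (ku kv kx p : ℕ) : Bool :=
  dki (W ku) != dki (W kv) && triAt (W ku) (W kv) (W kx) p

/-- two codes of distinct directions (returns the indices) -/
def twoFind (W : ℕ → MC) : Option (ℕ × ℕ) := pairs6.find? fun uv => dki (W uv.1) != dki (W uv.2)

/-- the β = 3 certificate for a pair `(a, b)` of codes, given `a⁻¹`: dead, or four support-independent
codes, or the recursive certificate from a support-triangular triple or from two directions -/
def checkCore15 (ac ai bc : MC) : Bool :=
  let bi := invT bc
  let x5 := mulT ac bi
  let x6 := mulT bc ai
  let W := sixF ac ai bc bi x5 x6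
  let d1 := dki oneC
  (List.range 6).any (fun k => dki (W k) == d1) ||
  (let S : Array ℕ := #[sp ac, sp ai, sp bc, sp bi, sp x5, sp x6]
   quadSearch W S ||
   match triFind W S with
   | some (ku, kv, kx, p) => triV W ku kv kx p && nodeB W 4 [W kx, W ku, W kv]
   | none =>
     match twoFind W with
     | some (ku, kv) => dki (W ku) != dki (W kv) && nodeB W 4 [W ku, W kv]
     | none => false)

/-- the certificate for one representative `a` against every invertible `b` -/
def checkRep15 (ac : MC) : Bool :=
  let ai := invT ac
  allMC.all fun bc => detC bc == 0 || checkCore15 ac ai bc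

/-- **The β = 3 certificate, part 1 of 5** (representatives `0 … 147`). -/
theorem fact_row3f1 : ((repsC.take 148).all checkRep15) = true := by
  native_decide

end Summit.MatrixMultiplication.MatrixMultiplication.Theorems.GradedDesignFamily.Negative.SubfieldNine
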